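import Summits.QuantumFields.YangMills.Theorems.PoincareLipschitzSobolevLocalL2Net
import Mathlib.MeasureTheory.Function.ConvergenceInMeasure
import HarnessLib

/-!
# Crux `BlockLipschitzL` (stmt-QuantumFields-23533) ∕ `HistoryTailL` (stmt-QuantumFields-19936), LINE 25 «CompactnessTransfer»,
# (C)-PROOF brick (C-a2) «STRONG `L²` COMPACTNESS OF BOUNDED SOBOLEV SEQUENCES ON A SET OF FINITE MEASURE»

Cell `ym3-torus` (YM ladder rung R3 = continuum SU(2) Yang–Mills on T³ — a RUNG, NOT the Clay problem: not d = 4, not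
infinite volume, not a mass gap); WIDTH helper seat `ym-ust-19936-w2` g13, (C)-PROOF lineage project (LEAD GO 13:49Z).
Helper `--supports stmt-QuantumFields-23533`; THEOREMS ONLY (0 `def`, 0 `sorry`, default heartbeats); imports: (C-a1)
✓`PoincareLipschitzSobolevLocalL2Net` (local `L²` nets), Mathlib (convergence in measure).

WHAT THIS FILE DOES (interior Rellich–Kondrachov, sequential form, for bounded maps on an open set of FINITE measure — the
open unit cube `Q` of the (C) row).  For `u_j` with weak gradients `Gs_j` on the open `Ω`, `μ Ω < ∞`, `‖u_j‖ ≤ B` on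
`Ω`, `‖Gs_j‖_{L²(Ω)} ≤ Λ < ∞`: ★★★ `exists_subseq_tendsto_eLpNorm_of_weakGrad` — a subsequence `φ` and a limit
`U ∈ L²(Ω)` with `‖u_{φ j} − U‖_{L²(Ω)} → 0` AND `u_{φ j} → U` a.e. on `Ω`.  Proof: `{u_j}` is totally bounded in `L²(Ω)`
(nets on the compact closures of an exhaustion by (C-a1), tails `≤ 2B·μ(Ω ∖ K)^{1∕2}` by the value bound), hence
precompact in the complete space `L²(Ω)`; a further subsequence converges a.e. (convergence in measure).

HONEST SCOPE.  Sobolev compactness bookkeeping; nothing of (C), (RS), S1″, S2♭″, `hHalvingBand`, K1, `MeanDeviationL`,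
`BlockLipschitzL`, `HistoryTailL` is proved here.  YM₃ on T³ is rung R3, not Clay; YM gap NOT proved.

References: L. C. Evans, Partial Differential Equations (2010) [Evans2010] (§5.7 Thm 1); R. A. Adams, Sobolev Spaces (1975)
[Adams1975] (Thm 6.2); L. Simon, Theorems on Regularity and Singularity of Energy Minimizing Maps (1996) [Simon1996] (§2.9).
-/

set_option autoImplicit false

noncomputable section

open MeasureTheory Set Function Filter Topology Metric TopologicalSpace
open scoped ContDiff ENNReal

namespace Summit.QuantumFields.YangMills.Theorems.PoincareLipschitzSobolevL2Compactness

open Literature.Analysis.FunctionSpaces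
open Summit.QuantumFields.YangMills.Theorems.PoincareLipschitzSobolevLocalL2Net

variable {E : Type*} [NormedAddCommGroup E] [NormedSpace ℝ E] [FiniteDimensional ℝ E]
  [MeasurableSpace E] [BorelSpace E] {μ : Measure E} [μ.IsAddHaarMeasure]
variable {F : Type*} [NormedAddCommGroup F] [NormedSpace ℝ F] [CompleteSpace F] [FiniteDimensional ℝ F]

/-! ## §1 Total boundedness in `L²(Ω)` -/

/-- ★★ **GLOBAL `L²(Ω)` NETS** (`μ Ω < ∞`): nets on a large compact (C-a1) plus small tails. [cite: Evans2010, §5.7 Theorem 1] -/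
theorem exists_finset_eLpNorm_sub_lt_of_weakGrad_of_measure_lt_top {Ω : Opens E} (hΩ : μ (Ω : Set E) < ⊤)
    {u : ℕ → E → F} {Gs : ℕ → E → E →L[ℝ] F} (hu : ∀ j, HasWeakFDerivOn Ω μ (u j) (Gs j)) {B : ℝ}
    (hB : ∀ j, ∀ x ∈ (Ω : Set E), ‖u j x‖ ≤ B) {Λ : ℝ≥0∞} (hΛ : Λ ≠ ⊤)
    (hGΛ : ∀ j, eLpNorm (Gs j) 2 (μ.restrict (Ω : Set E)) ≤ Λ) {ε : ℝ≥0∞} (hε : 0 < ε) :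
    ∃ s : Finset ℕ, ∀ j, ∃ m ∈ s, eLpNorm (fun x => u j x - u m x) 2 (μ.restrict (Ω : Set E)) < ε := by
  -- reduce to finite `ε`
  wlog hεt : ε ≠ ⊤ generalizing ε
  · obtain ⟨s, hs⟩ := this one_pos ENNReal.one_ne_top
    refine ⟨s, fun n => (hs n).imp fun m hm => ⟨hm.1, hm.2.trans_le ?_⟩⟩
    rw [not_ne_iff.1 hεt]; exact le_top
  have hΩm : MeasurableSet (Ω : Set E) := Ω.isOpen.measurableSet
  -- empty `Ω` is trivial
  by_cases hΩe : (Ω : Set E) = ∅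
  · refine ⟨{0}, fun j => ⟨0, Finset.mem_singleton_self 0, ?_⟩⟩
    rw [hΩe, Measure.restrict_empty, eLpNorm_measure_zero]
    exact hε
  obtain ⟨x₀, hx₀⟩ := Set.nonempty_iff_ne_empty.2 hΩe
  have hB0 : 0 ≤ B := (norm_nonneg _).trans (hB 0 x₀ hx₀)
  set η : ℝ≥0∞ := ε / 3 with hηdef
  have hη0 : 0 < η := ENNReal.div_pos hε.ne' (by norm_num)
  have hηt : η ≠ ⊤ := ENNReal.div_ne_top hεt (by norm_num)
  -- (1) exhaustion and a compact `K` with small complement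
  obtain ⟨V, hVmono, hVc, hVsucc, hVΩ, hΩV⟩ := MeyersSerrin.exists_exhaustion Ω
  have hUnion : (⋃ m, (V m : Set E)) = (Ω : Set E) :=
    Subset.antisymm (iUnion_subset fun m => hVΩ m) hΩV
  have hmono' : Monotone fun m => (V m : Set E) := fun a b hab => hVmono hab
  have htend : Tendsto (fun m => μ (V m : Set E)) atTop (𝓝 (μ (Ω : Set E))) := by
    have := tendsto_measure_iUnion_atTop (μ := μ) hmono'
    rwa [hUnion] at this
  -- choose `m` with `μ (Ω \\ V m) < (η / (2B+1))²`-type smallness; we ask `(2B+1)² μ(Ω \\ V m) ≤ η²` via the tail bound below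
  set τ : ℝ≥0∞ := (η / ENNReal.ofReal (2 * B + 1)) ^ 2 with hτdef
  have hτ0 : 0 < τ := ENNReal.pow_pos (ENNReal.div_pos hη0.ne' ENNReal.ofReal_ne_top) 2
  have hex : ∃ m, μ (Ω : Set E) < μ (V m : Set E) + τ := by
    have h1 : ∀ᶠ m in atTop, μ (Ω : Set E) < μ (V m : Set E) + τ := by
      have hlt : μ (Ω : Set E) < μ (Ω : Set E) + τ := ENNReal.lt_add_right hΩ.ne hτ0.ne'
      exact (htend.add tendsto_const_nhds).eventually (lt_mem_nhds hlt) |>.mono fun m hm => hm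
    exact h1.exists
  obtain ⟨m, hm⟩ := hex
  set K : Set E := closure (V m : Set E) with hKdef
  have hKc : IsCompact K := hVc m
  have hKΩ : K ⊆ (Ω : Set E) := (hVsucc m).trans (hVΩ (m + 1))
  have hKm : MeasurableSet K := isClosed_closure.measurableSet
  have hdiff : μ ((Ω : Set E) \ K) < τ := by
    have h1 : μ ((Ω : Set E) \ K) ≤ μ ((Ω : Set E) \ (V m : Set E)) := measure_mono (sdiff_subset_sdiff_right subset_closure)
    refine h1.trans_lt ?_
    have h2 : μ ((Ω : Set E) \ (V m : Set E)) = μ (Ω : Set E) - μ (V m : Set E) :=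
      measure_sdiff (hVΩ m) (V m).isOpen.measurableSet.nullMeasurableSet ((measure_mono (hVΩ m)).trans_lt hΩ).ne
    rw [h2]
    exact ENNReal.sub_lt_of_lt_add ((measure_mono (hVΩ m))) (by rwa [add_comm] at hm)
  -- (2) the net on `K`
  obtain ⟨s, hs⟩ := exists_finset_eLpNorm_sub_lt_of_weakGrad hu hB hΛ hGΛ hKc hKΩ hη0
  refine ⟨s, fun j => ?_⟩
  obtain ⟨k, hk, hjk⟩ := hs j
  refine ⟨k, hk, ?_⟩
  -- (3) split `Ω = K ∪ (Ω \\ K)`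
  have hsplit : (Ω : Set E) = K ∪ ((Ω : Set E) \ K) := (union_sdiff_cancel hKΩ).symm
  have hmeas : ∀ j, AEStronglyMeasurable (u j) (μ.restrict (Ω : Set E)) :=
    fun j => (hu j).locallyIntegrableOn.aestronglyMeasurable
  have htail : eLpNorm (fun x => u j x - u k x) 2 (μ.restrict ((Ω : Set E) \ K)) ≤ η := by
    have hbd : ∀ᵐ x ∂(μ.restrict ((Ω : Set E) \ K)), ‖u j x - u k x‖ ≤ 2 * B + 1 := by
      filter_upwards [ae_restrict_mem (hΩm.diff hKm)] with x hx
      calc ‖u j x - u k x‖ ≤ ‖u j x‖ + ‖u k x‖ := norm_sub_le _ _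
        _ ≤ B + B := add_le_add (hB j x hx.1) (hB k x hx.1)
        _ ≤ 2 * B + 1 := by linarith
    refine (eLpNorm_le_of_ae_bound hbd).trans ?_
    rw [Measure.restrict_apply_univ]
    have h2 : (2 : ℝ≥0∞).toReal⁻¹ = ((1 : ℝ) / 2) := by norm_num
    rw [h2]
    -- `μ(Ω \\ K)^{1/2} * (2B+1) ≤ τ^{1/2} (2B+1) = η`
    have h3 : μ ((Ω : Set E) \ K) ^ ((1 : ℝ) / 2) ≤ τ ^ ((1 : ℝ) / 2) := ENNReal.rpow_le_rpow hdiff.le (by norm_num)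
    have h4 : τ ^ ((1 : ℝ) / 2) = η / ENNReal.ofReal (2 * B + 1) := by
      rw [hτdef, ← ENNReal.rpow_natCast, ← ENNReal.rpow_mul]; norm_num
    have hpos : ENNReal.ofReal (2 * B + 1) ≠ 0 := by
      rw [ne_eq, ENNReal.ofReal_eq_zero, not_le]; linarith
    calc μ ((Ω : Set E) \ K) ^ ((1 : ℝ) / 2) * ENNReal.ofReal (2 * B + 1)
        ≤ τ ^ ((1 : ℝ) / 2) * ENNReal.ofReal (2 * B + 1) := mul_le_mul' h3 le_rfl
      _ = η := by rw [h4, ENNReal.div_mul_cancel hpos ENNReal.ofReal_ne_top]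
  have hunion : eLpNorm (fun x => u j x - u k x) 2 (μ.restrict (Ω : Set E)) ≤
      eLpNorm (fun x => u j x - u k x) 2 (μ.restrict K) + eLpNorm (fun x => u j x - u k x) 2 (μ.restrict ((Ω : Set E) \ K)) := by
    set f : E → F := fun x => u j x - u k x with hfdef
    have hfm : AEStronglyMeasurable f (μ.restrict (Ω : Set E)) := (hmeas j).sub (hmeas k)
    have hdec : f =ᵐ[μ.restrict (Ω : Set E)] fun x => K.indicator f x + ((Ω : Set E) \ K).indicator f x := by
      filter_upwards [ae_restrict_mem hΩm] with x hx
      by_cases hxK : x ∈ K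
      · rw [Set.indicator_of_mem hxK, Set.indicator_of_notMem (fun h => h.2 hxK), add_zero]
      · have hxD : x ∈ (Ω : Set E) \ K := ⟨hx, hxK⟩
        rw [Set.indicator_of_notMem hxK, Set.indicator_of_mem hxD, zero_add]
    rw [eLpNorm_congr_ae hdec]
    refine (eLpNorm_add_le (hfm.indicator hKm) (hfm.indicator (hΩm.diff hKm)) one_le_two).trans (le_of_eq ?_)
    rw [eLpNorm_indicator_eq_eLpNorm_restrict hKm, eLpNorm_indicator_eq_eLpNorm_restrict (hΩm.diff hKm),
      Measure.restrict_restrict hKm, Measure.restrict_restrict (hΩm.diff hKm),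
      Set.inter_eq_self_of_subset_left hKΩ, Set.inter_eq_self_of_subset_left sdiff_subset]
  refine hunion.trans_lt ?_
  calc eLpNorm (fun x => u j x - u k x) 2 (μ.restrict K) + eLpNorm (fun x => u j x - u k x) 2 (μ.restrict ((Ω : Set E) \ K))
      < η + η := ENNReal.add_lt_add_of_lt_of_le (ne_top_of_le_ne_top hηt htail) hjk htail
    _ ≤ η + η + η := le_self_add
    _ = ε := by rw [hηdef, ENNReal.add_thirds]

/-! ## §2 The convergent subsequence -/

/-- ★★★ **STRONG `L²(Ω)` COMPACTNESS FOR SEQUENCES BOUNDED IN `L^∞ ∩ W^{1,2}` ON A SET OF FINITE MEASURE** (interior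
Rellich–Kondrachov, sequential form, plus an a.e.-convergent refinement): there are a subsequence `φ` and `U ∈ L²(Ω)`
with `‖u_{φ j} − U‖_{L²(Ω)} → 0` and `u_{φ j} → U` a.e. on `Ω`. [cite: Evans2010, §5.7 Theorem 1; Adams1975, Theorem 6.2] -/
theorem exists_subseq_tendsto_eLpNorm_of_weakGrad {Ω : Opens E} (hΩ : μ (Ω : Set E) < ⊤)
    {u : ℕ → E → F} {Gs : ℕ → E → E →L[ℝ] F} (hu : ∀ j, HasWeakFDerivOn Ω μ (u j) (Gs j)) {B : ℝ}
    (hB : ∀ j, ∀ x ∈ (Ω : Set E), ‖u j x‖ ≤ B) {Λ : ℝ≥0∞} (hΛ : Λ ≠ ⊤)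
    (hGΛ : ∀ j, eLpNorm (Gs j) 2 (μ.restrict (Ω : Set E)) ≤ Λ) :
    ∃ (U : E → F) (φ : ℕ → ℕ), StrictMono φ ∧ MemLp U 2 (μ.restrict (Ω : Set E)) ∧
      Tendsto (fun j => eLpNorm (fun x => u (φ j) x - U x) 2 (μ.restrict (Ω : Set E))) atTop (𝓝 0) ∧
      ∀ᵐ x ∂(μ.restrict (Ω : Set E)), Tendsto (fun j => u (φ j) x) atTop (𝓝 (U x)) := by
  have hΩm : MeasurableSet (Ω : Set E) := Ω.isOpen.measurableSet
  haveI : IsFiniteMeasure (μ.restrict (Ω : Set E)) := isFiniteMeasure_restrict.2 hΩ.ne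
  haveI : Fact (1 ≤ (2 : ℝ≥0∞)) := ⟨one_le_two⟩
  have hmeas : ∀ j, AEStronglyMeasurable (u j) (μ.restrict (Ω : Set E)) :=
    fun j => (hu j).locallyIntegrableOn.aestronglyMeasurable
  have hmem : ∀ j, MemLp (u j) 2 (μ.restrict (Ω : Set E)) := fun j =>
    (memLp_top_of_bound (hmeas j) B (by filter_upwards [ae_restrict_mem hΩm] with x hx; exact hB j x hx)).mono_exponent
      le_top
  -- the sequence in `L²(Ω)` and its total boundedness
  let Φ : ℕ → Lp F 2 (μ.restrict (Ω : Set E)) := fun j => (hmem j).toLp (u j)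
  have htb : TotallyBounded (range Φ) := by
    refine EMetric.totallyBounded_iff.2 fun ε hε => ?_
    obtain ⟨s, hs⟩ := exists_finset_eLpNorm_sub_lt_of_weakGrad_of_measure_lt_top hΩ hu hB hΛ hGΛ hε
    refine ⟨Φ '' s, s.finite_toSet.image Φ, ?_⟩
    rintro _ ⟨n, rfl⟩
    obtain ⟨m, hm, hnm⟩ := hs n
    refine mem_iUnion₂.2 ⟨Φ m, mem_image_of_mem Φ hm, ?_⟩
    rw [Metric.mem_eball, Lp.edist_toLp_toLp]
    exact hnm
  have hcomp : IsCompact (closure (range Φ)) := htb.closure.isCompact_of_isClosed isClosed_closure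
  obtain ⟨g, -, φ, hφ, hlim⟩ := hcomp.tendsto_subseq (x := Φ) fun n => subset_closure (mem_range_self n)
  -- `L²` convergence of the functions
  have hL2 : Tendsto (fun j => eLpNorm (fun x => u (φ j) x - (g : E → F) x) 2 (μ.restrict (Ω : Set E))) atTop (𝓝 0) := by
    rw [tendsto_iff_edist_tendsto_0] at hlim
    refine hlim.congr fun n => ?_
    simp only [Function.comp_apply, Φ]
    rw [Lp.edist_def]
    exact eLpNorm_congr_ae (((hmem _).coeFn_toLp).sub EventuallyEq.rfl)
  -- an a.e.-convergent further subsequence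
  have hinm : TendstoInMeasure (μ.restrict (Ω : Set E)) (fun j => u (φ j)) atTop (g : E → F) :=
    tendstoInMeasure_of_tendsto_eLpNorm two_ne_zero (fun j => hmeas (φ j)) (Lp.aestronglyMeasurable g) hL2
  obtain ⟨ψ, hψ, hae⟩ := hinm.exists_seq_tendsto_ae
  refine ⟨(g : E → F), φ ∘ ψ, hφ.comp hψ, Lp.memLp g, hL2.comp hψ.tendsto_atTop, ?_⟩
  exact hae

end Summit.QuantumFields.YangMills.Theorems.PoincareLipschitzSobolevL2Compactness

end
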